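import Summits.RiemannHypothesis.RiemannHypothesis.Theorems.LiDirichletEchoImContour
import Summits.RiemannHypothesis.RiemannHypothesis.Theorems.LiDirichletEchoResonantTwist
import HarnessLib

/-!
# RiemannHypothesis / LiDirichletEcho — complex companion, part 3: the antisymmetric PRIME edge is MINUS the twisted
# complex chirp (RH-FREE, GRH-FREE)

RH-FREE · GRH-FREE [rh-li-eng g5].  Towards `LiTheory.LiZeroWindowEchoDirichletComplex` (imaginary channel).  With the
antisymmetrised weight `k⁻_n = F_n(w) − F_n(1 − w)` the `m = 2` term against `F_n(1 − w)` enters with a MINUS sign, so for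
`c ≥ 5/4`, all large `n` and window ends `√n ≤ T₁ ≤ √n + 1`, `c√n ≤ T₂ ≤ c√n + 1`:

  `|charPrimeEdgeIm χ n T₁ T₂ + A₂ n^{1/4} (Im χ(2) cos θ₀ − Re χ(2) sin θ₀)| ≤ C log² n`,  `θ₀ = 2√(n log 2) + π/4`,

uniformly in `χ`: the non-resonant terms are bounded by the ζ route's first-derivative tests exactly as in K2χ
(`CharPrimeEdge.charPrimeEdge_nonresonant`), and the resonant integral is the COMPLEX chirp `π A₂ n^{1/4} e^{−iθ₀}` up to
`O_c(log n)` (`CharPrimeEdge.resonant_integral_close`), whose product with `χ(2)` has imaginary part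
`π A₂ n^{1/4} (Im χ(2) cos θ₀ − Re χ(2) sin θ₀)`.  Nothing here bears on the truth of RH or GRH.
-/

noncomputable section

-- D-0017: `Summit.<S>.<S>.…` is the designed namespace of a single-problem summit.
set_option linter.dupNamespace false

open Complex MeasureTheory intervalIntegral Set
open scoped Real Interval ArithmeticFunction.vonMangoldt
open Literature.Analysis.Fourier

namespace Summit.RiemannHypothesis.RiemannHypothesis.Theorems.LiTheory

namespace ImPrimeEdgeChar

open PrimeEdge CharPrimeEdge

variable {q : ℕ}

/-- The IMAGINARY resonant piece: `(1/π) Im[χ(2) · ∫_{T₁}^{T₂} Λ(2) 2^{−w} z⁻ⁿ dy]`. -/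
def charEdgeTwoIm (χ : DirichletCharacter ℂ q) (n : ℕ) (T₁ T₂ : ℝ) : ℝ :=
  1 / Real.pi * (χ (2 : ZMod q) * ∫ y in T₁..T₂, (Λ 2 : ℂ) * (2 : ℂ) ^ (-liRightPt y) * (zq y ^ n)⁻¹).im

/-- `k⁻_n(3/2 + iy) = zⁿ − z⁻ⁿ`. -/
theorem liAntiWeight_rightPt (n : ℕ) (y : ℝ) : liAntiWeight n (liRightPt y) = zq y ^ n - (zq y ^ n)⁻¹ := by
  rw [liAntiWeight, liWeight_rightPt, liWeight_one_sub_rightPt]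

/-- `k⁻_n(w)` is continuous in `y`. -/
theorem continuous_antiWeight (n : ℕ) : Continuous fun y ↦ liAntiWeight n (liRightPt y) := by
  simp_rw [liAntiWeight_rightPt]; exact (continuous_zq.pow n).sub (continuous_zq_pow_inv n)

/-- **Non-resonant part of the antisymmetric prime edge** (`O_c(1)`, uniformly in `χ`): for `c ≥ 1` there is `C` with
`|charPrimeEdgeIm χ n T₁ T₂ + charEdgeTwoIm χ n T₁ T₂| ≤ C` whenever `n ≥ 1`, `√n ≤ T₁ ≤ T₂ ≤ c√n + 1`. -/
theorem charPrimeEdgeIm_nonresonant {c : ℝ} (hc : 1 ≤ c) :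
    ∃ C : ℝ, ∀ (χ : DirichletCharacter ℂ q) (n : ℕ), 1 ≤ n → ∀ T₁ T₂ : ℝ, Real.sqrt n ≤ T₁ → T₁ ≤ T₂ →
      T₂ ≤ c * Real.sqrt n + 1 → |charPrimeEdgeIm χ n T₁ T₂ + charEdgeTwoIm χ n T₁ T₂| ≤ C := by
  -- as `CharPrimeEdge.charPrimeEdge_nonresonant`, with the `F_n(1 − w)` terms subtracted instead of added
  set Kp : ℝ := 4 + 12 * (c + 1) with hKp
  set Km : ℝ := Real.exp 1 * (22 + 363 * (c + 1)) with hKm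
  have hKp0 : 0 ≤ Kp := by rw [hKp]; nlinarith
  have hKm0 : 0 ≤ Km := by rw [hKm]; positivity
  set g : ℕ → ℂ := fun m ↦ (Λ m : ℂ) with hg
  set S : ℝ := ∑' m : ℕ, ‖LSeries.term g (3 / 2 : ℂ) m‖ with hS
  refine ⟨1 / Real.pi * (S * (Kp + Km)), fun χ n hn T₁ T₂ h1 h12 h2 ↦ ?_⟩
  set f : ℕ → ℂ := fun m : ℕ ↦ χ (m : ZMod q) * (Λ m : ℂ) with hf
  have hsum := summable_norm_term
  set F : ℕ → ℝ → ℂ := fun m y ↦ LSeries.term f (liRightPt y) m * liAntiWeight n (liRightPt y) with hFdef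
  set Tp : ℕ → ℝ → ℂ := fun m y ↦ f m * ((m : ℂ) ^ (-liRightPt y) * zq y ^ n) with hTp
  set Tm : ℕ → ℝ → ℂ := fun m y ↦ f m * ((m : ℂ) ^ (-liRightPt y) * (zq y ^ n)⁻¹) with hTm
  have hF : ∀ m y, F m y = Tp m y - Tm m y := by
    intro m y; simp only [hFdef, hTp, hTm, hf, CharPrimeEdge.term_eq, liAntiWeight_rightPt]; ring
  have hJ : HasSum (fun m ↦ ∫ y in T₁..T₂, F m y)
      (∫ y in T₁..T₂, LSeries f (liRightPt y) * liAntiWeight n (liRightPt y)) := by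
    refine intervalIntegral.hasSum_integral_of_dominated_convergence
      (fun m _ ↦ ‖LSeries.term g (3 / 2 : ℂ) m‖ * (1 + Real.exp 1)) ?_ ?_ ?_ ?_ ?_
    · intro m; exact ((continuous_term χ m).mul (continuous_antiWeight n)).aestronglyMeasurable
    · intro m
      refine Filter.Eventually.of_forall fun y hy ↦ ?_
      rw [uIoc_of_le h12] at hy
      have hy' : Real.sqrt n ≤ y := h1.trans hy.1.le
      simp only [hFdef]
      rw [norm_mul]
      refine mul_le_mul (norm_term_rightPt_le χ y m) ?_ (norm_nonneg _) (norm_nonneg _)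
      rw [liAntiWeight_rightPt]
      exact (norm_sub_le _ _).trans (add_le_add (norm_zq_pow_le_one n y) (norm_zq_pow_inv_le n hy'))
    · refine Filter.Eventually.of_forall fun y _ ↦ ?_
      show Summable fun m ↦ ‖LSeries.term g (3 / 2 : ℂ) m‖ * (1 + Real.exp 1)
      exact hsum.mul_right (1 + Real.exp 1)
    · show IntervalIntegrable (fun _ : ℝ ↦ ∑' m : ℕ, ‖LSeries.term g (3 / 2 : ℂ) m‖ * (1 + Real.exp 1)) volume T₁ T₂
      exact intervalIntegrable_const
    · refine Filter.Eventually.of_forall fun y _ ↦ ?_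
      show HasSum (fun m ↦ LSeries.term f (liRightPt y) m * liAntiWeight n (liRightPt y))
        (LSeries f (liRightPt y) * liAntiWeight n (liRightPt y))
      exact (lseriesSummable_rightPt χ y).hasSum.mul_right (liAntiWeight n (liRightPt y))
  have hiTp : ∀ m, IntervalIntegrable (Tp m) volume T₁ T₂ := fun m ↦ by
    rcases Nat.eq_zero_or_pos m with rfl | hm
    · simp only [hTp, hf, ArithmeticFunction.map_zero, Complex.ofReal_zero, mul_zero, zero_mul]
      exact intervalIntegrable_const
    · exact (continuous_const.mul ((continuous_cpow_neg_rightPt hm).mul (continuous_zq.pow n))).intervalIntegrable _ _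
  have hiTm : ∀ m, IntervalIntegrable (Tm m) volume T₁ T₂ := fun m ↦ by
    rcases Nat.eq_zero_or_pos m with rfl | hm
    · simp only [hTm, hf, ArithmeticFunction.map_zero, Complex.ofReal_zero, mul_zero, zero_mul]
      exact intervalIntegrable_const
    · exact (continuous_const.mul ((continuous_cpow_neg_rightPt hm).mul (continuous_zq_pow_inv n))).intervalIntegrable
        _ _
  have hsplit : ∀ m, (∫ y in T₁..T₂, F m y) = (∫ y in T₁..T₂, Tp m y) - ∫ y in T₁..T₂, Tm m y := fun m ↦ by
    rw [← intervalIntegral.integral_sub (hiTp m) (hiTm m)]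
    exact intervalIntegral.integral_congr fun y _ ↦ hF m y
  have hfm : ∀ m, ‖f m‖ ≤ (Λ m : ℝ) := fun m ↦ by
    refine (norm_coeff_le χ m).trans ?_
    rw [Complex.norm_real, Real.norm_eq_abs, abs_of_nonneg ArithmeticFunction.vonMangoldt_nonneg]
  have hbTp : ∀ m, ‖∫ y in T₁..T₂, Tp m y‖ ≤ ‖LSeries.term g (3 / 2 : ℂ) m‖ * Kp := by
    intro m
    rcases lt_or_ge m 2 with hm | hm
    · have h0 := vonMangoldt_eq_zero_of_lt_two hm
      simp only [hTp, hf, h0, Complex.ofReal_zero, mul_zero, zero_mul, intervalIntegral.integral_zero, norm_zero]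
      positivity
    · have hm0 : 0 < m := by omega
      simp only [hTp]
      rw [intervalIntegral.integral_const_mul, norm_mul, norm_term_three_halves hm0, mul_assoc]
      exact mul_le_mul (hfm m) (norm_integral_plus_le hc hn hm h1 h12 h2) (norm_nonneg _)
        ArithmeticFunction.vonMangoldt_nonneg
  have hbTm : ∀ m, m ≠ 2 → ‖∫ y in T₁..T₂, Tm m y‖ ≤ ‖LSeries.term g (3 / 2 : ℂ) m‖ * Km := by
    intro m hm2
    rcases lt_or_ge m 2 with hm | hm
    · have h0 := vonMangoldt_eq_zero_of_lt_two hm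
      simp only [hTm, hf, h0, Complex.ofReal_zero, mul_zero, zero_mul, intervalIntegral.integral_zero, norm_zero]
      positivity
    · have hm3 : 3 ≤ m := by omega
      have hm0 : 0 < m := by omega
      simp only [hTm]
      rw [intervalIntegral.integral_const_mul, norm_mul, norm_term_three_halves hm0, mul_assoc]
      exact mul_le_mul (hfm m) (norm_integral_minus_le hc hn hm3 h1 h12 h2) (norm_nonneg _)
        ArithmeticFunction.vonMangoldt_nonneg
  set J : ℂ := ∫ y in T₁..T₂, LSeries f (liRightPt y) * liAntiWeight n (liRightPt y) with hJdef
  set I2 : ℂ := ∫ y in T₁..T₂, Tm 2 y with hI2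
  set G : ℕ → ℂ := fun m ↦ (∫ y in T₁..T₂, Tp m y) - if m = 2 then 0 else ∫ y in T₁..T₂, Tm m y with hG
  have hGsum : HasSum G (J + I2) := by
    have h2 := hasSum_ite_eq 2 I2
    have e : G = fun m ↦ (∫ y in T₁..T₂, F m y) + (if m = 2 then I2 else 0) := by
      funext m
      simp only [hG, hsplit]
      split_ifs with h
      · subst h; rw [hI2]; ring
      · ring
    rw [e]
    exact hJ.add h2
  have hGb : ∀ m, ‖G m‖ ≤ ‖LSeries.term g (3 / 2 : ℂ) m‖ * (Kp + Km) := by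
    intro m
    simp only [hG]
    split_ifs with h
    · rw [sub_zero, mul_add]
      have : 0 ≤ ‖LSeries.term g (3 / 2 : ℂ) m‖ * Km := by positivity
      linarith [hbTp m]
    · rw [mul_add]
      exact (norm_sub_le _ _).trans (add_le_add (hbTp m) (hbTm m h))
  have hnorm : ‖J + I2‖ ≤ S * (Kp + Km) := by
    rw [← hGsum.tsum_eq]
    have := tsum_of_norm_bounded (hsum.mul_right (Kp + Km)).hasSum hGb
    rwa [tsum_mul_right] at this
  have hfinal : charPrimeEdgeIm χ n T₁ T₂ + charEdgeTwoIm χ n T₁ T₂ = 1 / Real.pi * (J + I2).im := by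
    have hI2' : I2 = χ (2 : ZMod q) * ∫ y in T₁..T₂, (Λ 2 : ℂ) * (2 : ℂ) ^ (-liRightPt y) * (zq y ^ n)⁻¹ := by
      rw [hI2, ← intervalIntegral.integral_const_mul]
      refine intervalIntegral.integral_congr fun y _ ↦ ?_
      simp only [hTm, hf, Nat.cast_ofNat]
      ring
    unfold charPrimeEdgeIm charEdgeTwoIm
    rw [Complex.add_im, hI2', hJdef]
    ring
  rw [hfinal, abs_mul, abs_of_pos (by positivity : (0 : ℝ) < 1 / Real.pi)]
  refine mul_le_mul_of_nonneg_left ?_ (by positivity)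
  exact (Complex.abs_im_le_norm _).trans hnorm

/-- `Im[z · chirpTwo n] = π A₂ n^{1/4} (Im z cos θ₀ − Re z sin θ₀)`, `θ₀ = 2√(n log 2) + π/4`. -/
theorem im_mul_chirpTwo (z : ℂ) (n : ℕ) :
    (z * chirpTwo n).im = Real.pi * liEchoAmp * (n : ℝ) ^ (1 / 4 : ℝ) *
      (z.im * Real.cos (2 * Real.sqrt (n * Real.log 2) + Real.pi / 4)
        - z.re * Real.sin (2 * Real.sqrt (n * Real.log 2) + Real.pi / 4)) := by
  set θ₀ : ℝ := 2 * Real.sqrt (n * Real.log 2) + Real.pi / 4 with hθ₀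
  have hexp : Complex.exp (I * ((-θ₀ : ℝ) : ℂ)) = (Real.cos θ₀ : ℂ) - (Real.sin θ₀ : ℂ) * I := by
    rw [mul_comm I, Complex.exp_mul_I]
    push_cast
    rw [Complex.cos_neg, Complex.sin_neg]
    ring
  rw [chirpTwo, ← hθ₀, hexp]
  simp only [Complex.mul_re, Complex.mul_im, Complex.sub_re, Complex.sub_im, Complex.ofReal_re, Complex.ofReal_im,
    Complex.I_re, Complex.I_im]
  ring

/-- **Resonant part of the antisymmetric prime edge**: for `c ≥ 5/4` there are `N`, `C` with
`|charEdgeTwoIm χ n T₁ T₂ − A₂ n^{1/4}(Im χ(2) cos θ₀ − Re χ(2) sin θ₀)| ≤ C log n`, uniformly in `χ`. -/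
theorem charEdgeTwoIm_resonant {c : ℝ} (hc : 5 / 4 ≤ c) :
    ∃ N : ℕ, ∃ C : ℝ, ∀ (χ : DirichletCharacter ℂ q) (n : ℕ), N ≤ n → ∀ T₁ T₂ : ℝ,
      Real.sqrt n ≤ T₁ → T₁ ≤ Real.sqrt n + 1 → c * Real.sqrt n ≤ T₂ → T₂ ≤ c * Real.sqrt n + 1 →
        |charEdgeTwoIm χ n T₁ T₂ - liEchoAmp * (n : ℝ) ^ (1 / 4 : ℝ) *
            ((χ (2 : ZMod q)).im * Real.cos (2 * Real.sqrt (n * Real.log 2) + Real.pi / 4)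
              - (χ (2 : ZMod q)).re * Real.sin (2 * Real.sqrt (n * Real.log 2) + Real.pi / 4))| ≤ C * Real.log n := by
  obtain ⟨N, C, hC0, hN⟩ := resonant_integral_close hc
  refine ⟨max N 1, C, fun χ n hn T₁ T₂ h1 h1' h2 h2' ↦ ?_⟩
  have hnN : N ≤ n := le_trans (le_max_left _ _) hn
  have hD := hN n hnN T₁ T₂ h1 h1' h2 h2'
  set J : ℂ := ∫ y in T₁..T₂, (gA n y : ℂ) * Complex.exp (I * Ph n y) with hJ
  set z : ℂ := χ (2 : ZMod q) with hz
  have hz1 : ‖z‖ ≤ 1 := DirichletCharacter.norm_le_one χ _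
  have hpolar : charEdgeTwoIm χ n T₁ T₂ = 1 / Real.pi * (z * J).im := by
    rw [charEdgeTwoIm]
    congr 3
    exact intervalIntegral.integral_congr fun y _ ↦ resonant_polar n y
  have htw : liEchoAmp * (n : ℝ) ^ (1 / 4 : ℝ) *
      (z.im * Real.cos (2 * Real.sqrt (n * Real.log 2) + Real.pi / 4)
        - z.re * Real.sin (2 * Real.sqrt (n * Real.log 2) + Real.pi / 4)) = 1 / Real.pi * (z * chirpTwo n).im := by
    rw [im_mul_chirpTwo]; field_simp
  rw [hpolar, htw, ← mul_sub, ← Complex.sub_im, ← mul_sub, abs_mul,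
    abs_of_pos (by positivity : (0 : ℝ) < 1 / Real.pi)]
  have hπ1 : 1 / Real.pi ≤ 1 := by rw [div_le_one Real.pi_pos]; linarith [Real.pi_gt_three]
  calc 1 / Real.pi * |(z * (J - chirpTwo n)).im| ≤ 1 * (C * Real.log n) := by
        refine mul_le_mul hπ1 ?_ (abs_nonneg _) (by norm_num)
        calc |(z * (J - chirpTwo n)).im| ≤ ‖z * (J - chirpTwo n)‖ := Complex.abs_im_le_norm _
          _ = ‖z‖ * ‖J - chirpTwo n‖ := norm_mul _ _
          _ ≤ 1 * (C * Real.log n) := mul_le_mul hz1 hD (norm_nonneg _) (by norm_num)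
          _ = C * Real.log n := one_mul _
    _ = C * Real.log n := one_mul _

end ImPrimeEdgeChar

open ImPrimeEdgeChar in
/-- **The antisymmetric prime edge of `L(s, χ)` is MINUS the odd twisted echo** (RH-FREE, GRH-FREE): for `c ≥ 5/4` there are
`N`, `C` (independent of `χ`) with
`|charPrimeEdgeIm χ n T₁ T₂ + A₂ n^{1/4}(Im χ(2) cos θ₀ − Re χ(2) sin θ₀)| ≤ C log² n`
for `n ≥ N`, `√n ≤ T₁ ≤ √n + 1`, `c√n ≤ T₂ ≤ c√n + 1`. -/
theorem charPrimeEdgeIm_bound {q : ℕ} :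
    ∀ c : ℝ, 5 / 4 ≤ c → ∃ N : ℕ, ∃ C : ℝ, ∀ (χ : DirichletCharacter ℂ q) (n : ℕ), N ≤ n → ∀ T₁ T₂ : ℝ,
      Real.sqrt n ≤ T₁ → T₁ ≤ Real.sqrt n + 1 → c * Real.sqrt n ≤ T₂ → T₂ ≤ c * Real.sqrt n + 1 →
        |charPrimeEdgeIm χ n T₁ T₂ + liEchoAmp * (n : ℝ) ^ (1 / 4 : ℝ) *
            ((χ (2 : ZMod q)).im * Real.cos (2 * Real.sqrt (n * Real.log 2) + Real.pi / 4)
              - (χ (2 : ZMod q)).re * Real.sin (2 * Real.sqrt (n * Real.log 2) + Real.pi / 4))|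
          ≤ C * Real.log n ^ 2 := by
  intro c hc
  have hc1 : (1 : ℝ) ≤ c := by linarith
  obtain ⟨N, C, hN⟩ := charEdgeTwoIm_resonant (q := q) hc
  obtain ⟨C', hC'⟩ := charPrimeEdgeIm_nonresonant (q := q) hc1
  set ℓ : ℝ := Real.log 2 with hℓ_def
  have hℓ : 0 < ℓ := Real.log_pos (by norm_num)
  refine ⟨max N 16, |C'| / ℓ ^ 2 + |C| / ℓ, fun χ n hn T₁ T₂ h1 h2 h3 h4 ↦ ?_⟩
  have hnN : N ≤ n := le_trans (le_max_left _ _) hn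
  have hn2 : 2 ≤ n := le_trans (by norm_num) (le_trans (le_max_right _ _) hn)
  have hn16 : (16 : ℝ) ≤ n := by exact_mod_cast le_trans (le_max_right _ _) hn
  have hs4 : 4 ≤ Real.sqrt n := by
    have : Real.sqrt 16 = 4 := by
      rw [show (16 : ℝ) = 4 ^ 2 by norm_num]; exact Real.sqrt_sq (by norm_num)
    rw [← this]; exact Real.sqrt_le_sqrt hn16
  have hgap : 1 ≤ (c - 1) * Real.sqrt n := by
    have := mul_le_mul (show (1 / 4 : ℝ) ≤ c - 1 by linarith) hs4 (by norm_num) (by linarith)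
    linarith
  have h12 : T₁ ≤ T₂ := by nlinarith
  have hA := hN χ n hnN T₁ T₂ h1 h2 h3 h4
  have hB := hC' χ n (by omega) T₁ T₂ h1 h12 h4
  set L : ℝ := Real.log n with hL_def
  have hLℓ : ℓ ≤ L := Real.log_le_log (by norm_num) (by exact_mod_cast hn2)
  have hL0 : 0 ≤ L := hℓ.le.trans hLℓ
  have hL1 : (1 : ℝ) ≤ L ^ 2 / ℓ ^ 2 := by
    rw [one_le_div (by positivity)]; exact pow_le_pow_left₀ hℓ.le hLℓ 2
  have hL2 : L ≤ L ^ 2 / ℓ := by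
    rw [le_div_iff₀ hℓ, sq]; exact mul_le_mul_of_nonneg_left hLℓ hL0
  have b1 : C' ≤ |C'| * (L ^ 2 / ℓ ^ 2) := (le_abs_self C').trans (le_mul_of_one_le_right (abs_nonneg _) hL1)
  have b2 : C * L ≤ |C| * (L ^ 2 / ℓ) :=
    (mul_le_mul_of_nonneg_right (le_abs_self C) hL0).trans (mul_le_mul_of_nonneg_left hL2 (abs_nonneg _))
  have e : (|C'| / ℓ ^ 2 + |C| / ℓ) * L ^ 2 = |C'| * (L ^ 2 / ℓ ^ 2) + |C| * (L ^ 2 / ℓ) := by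
    field_simp
  rw [e]
  set E : ℝ := liEchoAmp * (n : ℝ) ^ (1 / 4 : ℝ) *
    ((χ (2 : ZMod q)).im * Real.cos (2 * Real.sqrt (n * Real.log 2) + Real.pi / 4)
      - (χ (2 : ZMod q)).re * Real.sin (2 * Real.sqrt (n * Real.log 2) + Real.pi / 4)) with hE
  have htri : |charPrimeEdgeIm χ n T₁ T₂ + E| ≤
      |charPrimeEdgeIm χ n T₁ T₂ + charEdgeTwoIm χ n T₁ T₂| + |charEdgeTwoIm χ n T₁ T₂ - E| := by
    have := abs_sub_le (charPrimeEdgeIm χ n T₁ T₂ + charEdgeTwoIm χ n T₁ T₂) 0 (charEdgeTwoIm χ n T₁ T₂ - E)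
    have e1 : charPrimeEdgeIm χ n T₁ T₂ + charEdgeTwoIm χ n T₁ T₂ - (charEdgeTwoIm χ n T₁ T₂ - E)
        = charPrimeEdgeIm χ n T₁ T₂ + E := by ring
    rw [e1, sub_zero, zero_sub, abs_neg] at this
    exact this
  linarith

end Summit.RiemannHypothesis.RiemannHypothesis.Theorems.LiTheory

end
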